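import Summits.QuantumFields.BalabanUV.Beta.SubsolutionMeanValueBox

/-!
# Beta / SubsolutionMeanValueL1 — THE L¹ MEAN-VALUE INEQUALITY AT THE CENTRE FOR NONNEGATIVE SUB-SOLUTIONS OF THE FREE LATTICE
# LAPLACIAN ON A TORUS BOX, `z(x₀) ≤ C_d·R^{−d}·Σ_{dist ≤ R} z`, IN THE KERNEL — the owner's binder `hMV` of
# `MultiscaleRegularityOfMeanValue.hreg_of_meanValue` in its own syntactic shape (room condition `10r + 4 ≤ N_μ`)
# (MODEL; unit torus `UT N`; fifth module of «LATTICE-DEGIORGI-MV»)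

FROM ℓ² TO L¹ (the classical sup-interpolation).  `SubsolutionMeanValueBox.meanValue_ball` bounds a nonnegative sub-solution at a
centre by the ℓ² average over a ball with room `10n + 4 ≤ N_μ`.  Along the dyadic EXHAUSTION `ρ_t = 2^{m+1} − 2^t` (`t = 0…m+1`,
`2^{m+1} ≤ R < 2^{m+2}`) of the ball of radius `R` round `x₀`: if `z ≤ b_t` on `dist ≤ ρ_t`, then at a site `x` with `dist(x,x₀) ≤ ρ_{t+1}`
the ball of radius `2^t` round `x` lies inside `dist ≤ ρ_t`, so `Σ_{ball} z² ≤ b_t·Σ_{dist ≤ R} z =: b_t·U₁` and the ℓ² bound with AM–GM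
gives `z(x) ≤ b_t/2^{d+1} + 2^d·C²·U₁/(2·2^{dt})`; the invariant `b_t ≤ U₁·(2^{−(d+1)t} + C²4^d/2^{dt})` propagates EXACTLY, and at
`t = m + 1` (radius `0`) it reads `z(x₀) ≤ 2^d(1 + 4^dC²)·U₁/R^d`.
CONTENT (kernel, 0 sorry): §1 the exhaustion radii; §2 **`meanValueL1_ball`** (W∕N shape of files 12∕14∕P3, constant weight `c ≡ c₀ ≠ 0`,
`R ≥ 1`, `10R + 4 ≤ N_i`): `z(x₀) ≤ C¹_d·(Σ_{dist ≤ R} z)/R^d`, `C¹_d = 2^d(1 + 4^d·C_d²)`; §3 **`hMV_holds`** — THE OWNER'S BINDER: for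
every `x₀`, every `r` with `10r + 4 ≤ N_μ`, every `z ≥ 0` with `2d·z(x) ≤ Σ_μ (z(x+e_μ) + z(x−e_μ))` on `dist(·,x₀) ≤ r`:
`z(x₀) ≤ CMV_d/(2r+1)^d·Σ_{dist ≤ r} z` with `CMV_d = 3^d·C¹_d ≥ 1` (`r = 0` by `CMV_d ≥ 1`; the Laplacian form is the W∕N form for `c ≡ 1`).
The room `10r + 4 ≤ N_μ` (the Faber–Krahn tiles' window) replaces the owner's `2r + 2 ≤ N_μ`: his `r = ⌊θn(x₀)⌋` meets it after shrinking
`θ` (adapter on the consumer's side, as offered in journal l.22701), or this lineage relaxes it (bounding `X ≤ R` in `DeGiorgiStep.step`).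
(unit `b2b-balaban-beta-d4-p2`, GEN 10, MODEL crew; claim «LATTICE-DEGIORGI-MV» journal l.22396; consumer an4-g45's file 16c.)

HONEST FRAMING: discharging `BetaPertH` makes Bałaban's UV stability UNCONDITIONAL — NOT the continuum limit, NOT the
Clay problem.  HONEST DEPENDENCY (verbatim): «continuum YM on T⁴ ⇐ BetaPertH ∧ nine spine estimates (0/9 proved);
BetaPertH ⇐ (D1) ∧ (D4) ∧ CAP+tail; G-an2-4 gates asym, D1 and NE2/3/4.»  THIS MODULE DISCHARGES NOTHING of `BetaPertH`,
asserts NOTHING printed and cites nothing as a fact (ABSOLUTE RULE): [folklore] finite lattice calculus (the L^p-interpolation step of the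
De Giorgi–Nash–Moser theory — method pointer only).  No class change on row D4 (critical-path width 0; D4 DISCHARGE NO DATE); NOT BetaPertH,
NOT continuum, NOT Clay, NOT summit progress.
-/

open scoped BigOperators
open Finset

namespace Summit.QuantumFields.BalabanUV.Beta.SubsolutionMeanValueL1

open Literature.MathematicalPhysics.QuantumFieldTheory.Balaban1983to89
open Literature.MathematicalPhysics.QuantumFieldTheory.Balaban1983to89.B9Thm37GluePU (bsrc btgt)
open B5TorusCover (UT)
open B5Leibniz121 (up dn)
open Summit.QuantumFields.BalabanUV.Beta.DeGiorgiStep (W_const)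
open Summit.QuantumFields.BalabanUV.Beta.SubsolutionMeanValueBox (Cmv Cmv_pos meanValue_ball)
open Summit.QuantumFields.BalabanUV.Beta.TorusBoxSupersolution (wsum_src_const wsum_tgt_const)

noncomputable section

variable {d : ℕ} {N : Fin d → ℕ} [∀ i, NeZero (N i)]

/-! ## §1 The dyadic exhaustion of the ball -/

/-- The exhaustion radii `ρ_t = 2^{m+1} − 2^t` (`t` steps of the interpolation still to go; `ρ_{m+1} = 0`). [folklore] -/
def erad (m t : ℕ) : ℕ := 2 ^ (m + 1) - 2 ^ t

omit [∀ i, NeZero (N i)] in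
/-- `ρ_{t+1} + 2^t = ρ_t` for `t ≤ m`. [folklore] -/
theorem erad_succ_add {m t : ℕ} (ht : t ≤ m) : erad m (t + 1) + 2 ^ t = erad m t := by
  unfold erad
  have h1 : 2 ^ (t + 1) = 2 * 2 ^ t := by rw [pow_succ]; ring
  have h2 : 2 ^ (t + 1) ≤ 2 ^ (m + 1) := Nat.pow_le_pow_right (by norm_num) (by omega)
  omega

omit [∀ i, NeZero (N i)] in
/-- `ρ_t ≤ R − 1` when `2^{m+1} ≤ R`. [folklore] -/
theorem erad_lt {R m : ℕ} (hm : 2 ^ (m + 1) ≤ R) (t : ℕ) : erad m t + 1 ≤ R := by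
  unfold erad
  have h1 : 1 ≤ 2 ^ t := Nat.one_le_two_pow
  have h2 : 1 ≤ 2 ^ (m + 1) := Nat.one_le_two_pow
  omega

omit [∀ i, NeZero (N i)] in
/-- `ρ_{m+1} = 0`. [folklore] -/
theorem erad_last (m : ℕ) : erad m (m + 1) = 0 := by unfold erad; omega

/-! ## §2 The L¹ mean-value inequality at the centre -/

/-- `C¹_d = 2^d·(1 + 4^d·C_d²)`. [folklore] -/
def CL1 (d : ℕ) : ℝ := 2 ^ d * (1 + 4 ^ d * Cmv d ^ 2)

omit [∀ i, NeZero (N i)] in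
/-- `C¹_d ≥ 1`. [folklore] -/
theorem one_le_CL1 (d : ℕ) : 1 ≤ CL1 d := by
  unfold CL1
  have h1 : (1 : ℝ) ≤ 2 ^ d := one_le_pow₀ (by norm_num)
  have h2 : (0 : ℝ) ≤ 4 ^ d * Cmv d ^ 2 := by positivity
  nlinarith

/-- **THE INTERPOLATION INVARIANT**: along the exhaustion, `z ≤ U₁·(2^{−(d+1)t} + C_d²·4^d/2^{dt})` on `dist ≤ ρ_t`, `U₁ = Σ_{dist ≤ R} z`.
[folklore] -/
theorem invariant [NeZero d] {c : UT N × Fin d → ℝ} {c₀ : ℝ} (hc : ∀ b, c b = c₀) (hc₀ : c₀ ≠ 0) (x₀ : UT N) {R m : ℕ}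
    (hm : 2 ^ (m + 1) ≤ R) (hN : ∀ i, 10 * R + 4 ≤ N i) (z : UT N → ℝ) (hz0 : ∀ y, 0 ≤ z y)
    (hz : ∀ x ∈ univ.filter (fun x : UT N => dist x x₀ ≤ R),
      ((∑ b ∈ univ.filter (fun b : UT N × Fin d => btgt b = x), c b ^ 2) +
          ∑ b ∈ univ.filter (fun b : UT N × Fin d => bsrc b = x), c b ^ 2) * z x ≤
        ((∑ b ∈ univ.filter (fun b : UT N × Fin d => btgt b = x), c b ^ 2 * z (bsrc b)) +
          ∑ b ∈ univ.filter (fun b : UT N × Fin d => bsrc b = x), c b ^ 2 * z (btgt b))) :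
    ∀ t, t ≤ m + 1 → ∀ x : UT N, dist x x₀ ≤ ((erad m t : ℕ) : ℝ) →
      z x ≤ (∑ y ∈ univ.filter (fun y : UT N => dist y x₀ ≤ R), z y) *
        (1 / 2 ^ ((d + 1) * t) + Cmv d ^ 2 * 4 ^ d / 2 ^ (d * t)) := by
  have hd1 : 1 ≤ d := Nat.one_le_iff_ne_zero.mpr (NeZero.ne d)
  set U1 : ℝ := ∑ y ∈ univ.filter (fun y : UT N => dist y x₀ ≤ R), z y with hU1
  have hU10 : 0 ≤ U1 := Finset.sum_nonneg fun y _ => hz0 y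
  have hC0 := Cmv_pos hd1
  -- every site of the big ball is below the L¹ mass
  have htriv : ∀ x : UT N, dist x x₀ ≤ R → z x ≤ U1 := fun x hx =>
    Finset.single_le_sum (f := z) (fun y _ => hz0 y) (Finset.mem_filter.mpr ⟨Finset.mem_univ _, hx⟩)
  intro t
  induction t with
  | zero =>
    intro _ x hx
    have hxR : dist x x₀ ≤ R := hx.trans (by exact_mod_cast (erad_lt hm 0).trans' (Nat.le_succ _))
    have h1 : U1 ≤ U1 * (1 / 2 ^ ((d + 1) * 0) + Cmv d ^ 2 * 4 ^ d / 2 ^ (d * 0)) := by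
      simp only [mul_zero, pow_zero, div_one]
      have : 0 ≤ U1 * (Cmv d ^ 2 * 4 ^ d) := by positivity
      linarith
    exact (htriv x hxR).trans h1
  | succ t ih =>
    intro ht x hx
    have htm : t ≤ m := by omega
    have IH := ih (by omega)
    set T : ℝ := 2 ^ t with hT
    have hT0 : 0 < T := by positivity
    set b : ℝ := U1 * (1 / 2 ^ ((d + 1) * t) + Cmv d ^ 2 * 4 ^ d / 2 ^ (d * t)) with hb
    have hb0 : 0 ≤ b := by positivity
    -- the ball of radius `2^t` round `x` lies inside `dist ≤ ρ_t ≤ R − 1`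
    have hsub_ball : ∀ y : UT N, dist y x ≤ ((2 ^ t : ℕ) : ℝ) → dist y x₀ ≤ ((erad m t : ℕ) : ℝ) := by
      intro y hy
      have e := erad_succ_add htm
      calc dist y x₀ ≤ dist y x + dist x x₀ := dist_triangle _ _ _
        _ ≤ ((2 ^ t : ℕ) : ℝ) + ((erad m (t + 1) : ℕ) : ℝ) := add_le_add hy hx
        _ = ((erad m t : ℕ) : ℝ) := by rw [← e]; push_cast; ring
    have hballR : ∀ y : UT N, dist y x ≤ ((2 ^ t : ℕ) : ℝ) → dist y x₀ ≤ R := fun y hy =>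
      (hsub_ball y hy).trans (by exact_mod_cast (erad_lt hm t).trans' (Nat.le_succ _))
    -- the ℓ² mean-value bound at `x` with radius `2^t`
    have hn1 : 1 ≤ 2 ^ t := Nat.one_le_two_pow
    have hnR : 2 ^ t ≤ R := by
      have : 2 ^ t ≤ 2 ^ (m + 1) := Nat.pow_le_pow_right (by norm_num) (by omega)
      omega
    have hNn : ∀ i, 10 * 2 ^ t + 4 ≤ N i := fun i => by have := hN i; omega
    have hzx : ∀ y ∈ univ.filter (fun y : UT N => dist y x ≤ ((2 ^ t : ℕ) : ℕ)),
        ((∑ b ∈ univ.filter (fun b : UT N × Fin d => btgt b = y), c b ^ 2) +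
            ∑ b ∈ univ.filter (fun b : UT N × Fin d => bsrc b = y), c b ^ 2) * z y ≤
          ((∑ b ∈ univ.filter (fun b : UT N × Fin d => btgt b = y), c b ^ 2 * z (bsrc b)) +
            ∑ b ∈ univ.filter (fun b : UT N × Fin d => bsrc b = y), c b ^ 2 * z (btgt b)) := by
      intro y hy
      exact hz y (Finset.mem_filter.mpr ⟨Finset.mem_univ _, hballR y (by exact_mod_cast (Finset.mem_filter.mp hy).2)⟩)
    have hMV := meanValue_ball hc hc₀ x hn1 hNn z hz0 hzx
    -- `Σ_{ball} z² ≤ b·U₁`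
    have hS : ∑ y ∈ univ.filter (fun y : UT N => dist y x ≤ ((2 ^ t : ℕ) : ℕ)), z y ^ 2 ≤ b * U1 := by
      calc ∑ y ∈ univ.filter (fun y : UT N => dist y x ≤ ((2 ^ t : ℕ) : ℕ)), z y ^ 2
          ≤ ∑ y ∈ univ.filter (fun y : UT N => dist y x ≤ ((2 ^ t : ℕ) : ℕ)), b * z y := by
            refine Finset.sum_le_sum fun y hy => ?_
            have hyb : z y ≤ b := IH y (hsub_ball y (by exact_mod_cast (Finset.mem_filter.mp hy).2))
            rw [sq]; exact mul_le_mul_of_nonneg_right hyb (hz0 y)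
        _ = b * ∑ y ∈ univ.filter (fun y : UT N => dist y x ≤ ((2 ^ t : ℕ) : ℕ)), z y := by rw [Finset.mul_sum]
        _ ≤ b * U1 := by
            refine mul_le_mul_of_nonneg_left ?_ hb0
            exact Finset.sum_le_sum_of_subset_of_nonneg
              (fun y hy => Finset.mem_filter.mpr ⟨Finset.mem_univ _, hballR y (by exact_mod_cast (Finset.mem_filter.mp hy).2)⟩)
              fun y _ _ => hz0 y
    -- AM–GM: `C·√(bU₁/T^d) ≤ b/2^{d+1} + 2^d C² U₁/(2T^d)`
    have hTd : ((2 ^ t : ℕ) : ℝ) ^ d = T ^ d := by rw [hT]; push_cast; ring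
    have hzle : z x ≤ b / 2 ^ (d + 1) + 2 ^ d * Cmv d ^ 2 * U1 / (2 * T ^ d) := by
      have h1 : z x ≤ Cmv d * Real.sqrt (b * U1 / T ^ d) := by
        refine hMV.trans (mul_le_mul_of_nonneg_left (Real.sqrt_le_sqrt ?_) hC0.le)
        rw [hTd]
        exact div_le_div_of_nonneg_right hS (by positivity)
      set P : ℝ := b / 2 ^ (d + 1) with hP
      set Q : ℝ := 2 ^ d * Cmv d ^ 2 * U1 / (2 * T ^ d) with hQ
      have hP0 : 0 ≤ P := by positivity
      have hQ0 : 0 ≤ Q := by positivity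
      have hsq : (Cmv d * Real.sqrt (b * U1 / T ^ d)) ^ 2 = 4 * P * Q := by
        rw [mul_pow, Real.sq_sqrt (by positivity), hP, hQ]
        field_simp
        ring
      have h2 : (Cmv d * Real.sqrt (b * U1 / T ^ d)) ^ 2 ≤ (P + Q) ^ 2 := by
        rw [hsq]; nlinarith [sq_nonneg (P - Q)]
      exact h1.trans (le_of_pow_le_pow_left₀ two_ne_zero (by positivity) h2)
    -- the invariant propagates exactly
    refine hzle.trans (le_of_eq ?_)
    rw [hb]
    have e1 : (2 : ℝ) ^ ((d + 1) * (t + 1)) = 2 ^ ((d + 1) * t) * 2 ^ (d + 1) := by rw [mul_add, mul_one, pow_add]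
    have e2 : (2 : ℝ) ^ (d * (t + 1)) = T ^ d * 2 ^ d := by rw [mul_add, mul_one, pow_add, pow_mul, hT]; ring
    have e3 : (2 : ℝ) ^ (d * t) = T ^ d := by rw [hT, ← pow_mul, mul_comm]
    rw [e1, e2, e3]
    have e4 : (4 : ℝ) ^ d = 2 ^ d * 2 ^ d := by rw [← mul_pow]; norm_num
    rw [e4]
    field_simp
    ring

/-- **THE L¹ MEAN-VALUE INEQUALITY AT THE CENTRE (free lattice Laplacian, torus box, constant weight).**  `c ≡ c₀ ≠ 0`, `R ≥ 1`,
`10R + 4 ≤ N_i`; every `z ≥ 0` with `W·z ≤ Nz` on `dist(·, x₀) ≤ R` satisfies `z(x₀) ≤ C¹_d·(Σ_{dist ≤ R} z)/R^d`. [folklore] -/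
theorem meanValueL1_ball [NeZero d] {c : UT N × Fin d → ℝ} {c₀ : ℝ} (hc : ∀ b, c b = c₀) (hc₀ : c₀ ≠ 0) (x₀ : UT N) {R : ℕ}
    (hR : 1 ≤ R) (hN : ∀ i, 10 * R + 4 ≤ N i) (z : UT N → ℝ) (hz0 : ∀ y, 0 ≤ z y)
    (hz : ∀ x ∈ univ.filter (fun x : UT N => dist x x₀ ≤ R),
      ((∑ b ∈ univ.filter (fun b : UT N × Fin d => btgt b = x), c b ^ 2) +
          ∑ b ∈ univ.filter (fun b : UT N × Fin d => bsrc b = x), c b ^ 2) * z x ≤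
        ((∑ b ∈ univ.filter (fun b : UT N × Fin d => btgt b = x), c b ^ 2 * z (bsrc b)) +
          ∑ b ∈ univ.filter (fun b : UT N × Fin d => bsrc b = x), c b ^ 2 * z (btgt b))) :
    z x₀ ≤ CL1 d * (∑ x ∈ univ.filter (fun x : UT N => dist x x₀ ≤ R), z x) / (R : ℝ) ^ d := by
  have hd1 : 1 ≤ d := Nat.one_le_iff_ne_zero.mpr (NeZero.ne d)
  set U1 : ℝ := ∑ x ∈ univ.filter (fun x : UT N => dist x x₀ ≤ R), z x with hU1
  have hU10 : 0 ≤ U1 := Finset.sum_nonneg fun y _ => hz0 y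
  have hR0 : (0 : ℝ) < R := by exact_mod_cast hR
  have hzU : z x₀ ≤ U1 :=
    Finset.single_le_sum (f := z) (fun y _ => hz0 y) (Finset.mem_filter.mpr ⟨Finset.mem_univ _, by rw [dist_self]; positivity⟩)
  by_cases hR1 : R = 1
  · subst hR1
    simp only [Nat.cast_one, one_pow, div_one]
    calc z x₀ ≤ U1 := hzU
      _ = 1 * U1 := (one_mul _).symm
      _ ≤ CL1 d * U1 := mul_le_mul_of_nonneg_right (one_le_CL1 d) hU10
  -- dyadic depth
  have hR2 : 2 ≤ R := by omega
  set m : ℕ := Nat.log 2 R - 1 with hmdef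
  have hlog : 1 ≤ Nat.log 2 R := Nat.log_pos (by norm_num) hR2
  have hm : 2 ^ (m + 1) ≤ R := by
    rw [show m + 1 = Nat.log 2 R by omega]; exact Nat.pow_log_le_self 2 (by omega)
  have hRlt : R < 2 ^ (m + 2) := by
    rw [show m + 2 = (Nat.log 2 R).succ by omega]; exact Nat.lt_pow_succ_log_self (by norm_num) R
  -- the invariant at `t = m + 1` (radius `0`)
  have h := invariant hc hc₀ x₀ hm hN z hz0 hz (m + 1) le_rfl x₀ (by rw [dist_self]; positivity)
  -- `2^{-(d+1)(m+1)} ≤ 2^{-d(m+1)} ≤ 2^d/R^d`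
  set M : ℝ := 2 ^ m with hM
  have hM0 : 0 < M := by positivity
  have hRM : (R : ℝ) ^ d ≤ 4 ^ d * M ^ d := by
    have h1 : (R : ℝ) ≤ 4 * M := by
      have : ((R : ℕ) : ℝ) < ((2 ^ (m + 2) : ℕ) : ℝ) := by exact_mod_cast hRlt
      have e : ((2 ^ (m + 2) : ℕ) : ℝ) = 4 * M := by push_cast; rw [pow_add]; ring
      linarith
    calc (R : ℝ) ^ d ≤ (4 * M) ^ d := pow_le_pow_left₀ hR0.le h1 d
      _ = 4 ^ d * M ^ d := mul_pow _ _ _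
  have e1 : (2 : ℝ) ^ (d * (m + 1)) = 2 ^ d * M ^ d := by rw [mul_add, mul_one, pow_add, pow_mul, hM]; ring
  have e2 : (2 : ℝ) ^ ((d + 1) * (m + 1)) = 2 ^ (d * (m + 1)) * 2 ^ (m + 1) := by rw [← pow_add]; ring_nf
  have hA : 1 / (2 : ℝ) ^ ((d + 1) * (m + 1)) ≤ 2 ^ d / (R : ℝ) ^ d := by
    rw [e2, e1, div_le_div_iff₀ (by positivity) (by positivity)]
    have h21 : (1 : ℝ) ≤ 2 ^ (m + 1) := one_le_pow₀ (by norm_num)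
    calc 1 * (R : ℝ) ^ d ≤ 4 ^ d * M ^ d := by rw [one_mul]; exact hRM
      _ = 2 ^ d * (2 ^ d * M ^ d) * 1 := by rw [show (4 : ℝ) ^ d = 2 ^ d * 2 ^ d by rw [← mul_pow]; norm_num]; ring
      _ ≤ 2 ^ d * (2 ^ d * M ^ d) * 2 ^ (m + 1) := mul_le_mul_of_nonneg_left h21 (by positivity)
      _ = 2 ^ d * (2 ^ d * M ^ d * 2 ^ (m + 1)) := by ring
  have hB : Cmv d ^ 2 * 4 ^ d / (2 : ℝ) ^ (d * (m + 1)) ≤ Cmv d ^ 2 * 4 ^ d * (2 ^ d / (R : ℝ) ^ d) := by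
    rw [e1, div_eq_mul_one_div (Cmv d ^ 2 * 4 ^ d)]
    refine mul_le_mul_of_nonneg_left ?_ (by positivity)
    rw [div_le_div_iff₀ (by positivity) (by positivity)]
    calc 1 * (R : ℝ) ^ d ≤ 4 ^ d * M ^ d := by rw [one_mul]; exact hRM
      _ = 2 ^ d * (2 ^ d * M ^ d) := by rw [show (4 : ℝ) ^ d = 2 ^ d * 2 ^ d by rw [← mul_pow]; norm_num]; ring
  calc z x₀ ≤ U1 * (1 / 2 ^ ((d + 1) * (m + 1)) + Cmv d ^ 2 * 4 ^ d / 2 ^ (d * (m + 1))) := h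
    _ ≤ U1 * (2 ^ d / (R : ℝ) ^ d + Cmv d ^ 2 * 4 ^ d * (2 ^ d / (R : ℝ) ^ d)) :=
        mul_le_mul_of_nonneg_left (add_le_add hA hB) hU10
    _ = CL1 d * U1 / (R : ℝ) ^ d := by unfold CL1; ring

/-! ## §3 The owner's binder -/

/-- `CMV_d = 3^d·C¹_d` — the constant of the owner's binder (normalisation by `(2r+1)^d`). [folklore] -/
def CMV (d : ℕ) : ℝ := 3 ^ d * CL1 d

omit [∀ i, NeZero (N i)] in
/-- `CMV_d ≥ 1` (needed by the consumer at `r = 0`). [folklore] -/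
theorem one_le_CMV (d : ℕ) : 1 ≤ CMV d := by
  unfold CMV
  have h1 : (1 : ℝ) ≤ 3 ^ d := one_le_pow₀ (by norm_num)
  nlinarith [one_le_CL1 d]

omit [∀ i, NeZero (N i)] in
/-- `CMV_d ≥ 0` (the form the owner's adapter `MeanValueBinderAdapter.l1binder_of_roomy10` takes). [folklore] -/
theorem CMV_nonneg (d : ℕ) : 0 ≤ CMV d := zero_le_one.trans (one_le_CMV d)

/-- **THE MEAN-VALUE BINDER `hMV` OF `MultiscaleRegularityOfMeanValue.hreg_of_meanValue`, PROVED** (room `10r + 4 ≤ N_μ` in place of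
`2r + 2 ≤ N_μ`): for every centre `x₀`, radius `r`, and `z ≥ 0` with `2d·z(x) ≤ Σ_μ (z(x+e_μ) + z(x−e_μ))` on `dist(·, x₀) ≤ r`,
`z(x₀) ≤ CMV_d/(2r+1)^d·Σ_{dist ≤ r} z`. [folklore] -/
theorem hMV_holds [NeZero d] (x₀ : UT N) (r : ℕ) (hN : ∀ μ, 10 * r + 4 ≤ N μ) (z : UT N → ℝ) (hz0 : ∀ y, 0 ≤ z y)
    (hz : ∀ x, dist x x₀ ≤ r → 2 * d * z x ≤ ∑ μ, (z (up x μ) + z (dn x μ))) :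
    z x₀ ≤ CMV d / (2 * r + 1 : ℝ) ^ d * ∑ x ∈ univ.filter (fun x : UT N => dist x x₀ ≤ r), z x := by
  have hS0 : 0 ≤ ∑ x ∈ univ.filter (fun x : UT N => dist x x₀ ≤ r), z x := Finset.sum_nonneg fun y _ => hz0 y
  have hzU : z x₀ ≤ ∑ x ∈ univ.filter (fun x : UT N => dist x x₀ ≤ r), z x :=
    Finset.single_le_sum (f := z) (fun y _ => hz0 y) (Finset.mem_filter.mpr ⟨Finset.mem_univ _, by rw [dist_self]; positivity⟩)
  by_cases hr : r = 0
  · have e : (2 * r + 1 : ℝ) ^ d = 1 := by rw [hr]; norm_num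
    rw [e, div_one]
    calc z x₀ ≤ _ := hzU
      _ = 1 * _ := (one_mul _).symm
      _ ≤ CMV d * _ := mul_le_mul_of_nonneg_right (one_le_CMV d) hS0
  have hr1 : 1 ≤ r := Nat.one_le_iff_ne_zero.mpr hr
  -- the Laplacian form is the W/N form for the unit weight
  set c : UT N × Fin d → ℝ := fun _ => 1 with hcdef
  have hc : ∀ b, c b = 1 := fun _ => rfl
  have hzWN : ∀ x ∈ univ.filter (fun x : UT N => dist x x₀ ≤ r),
      ((∑ b ∈ univ.filter (fun b : UT N × Fin d => btgt b = x), c b ^ 2) +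
          ∑ b ∈ univ.filter (fun b : UT N × Fin d => bsrc b = x), c b ^ 2) * z x ≤
        ((∑ b ∈ univ.filter (fun b : UT N × Fin d => btgt b = x), c b ^ 2 * z (bsrc b)) +
          ∑ b ∈ univ.filter (fun b : UT N × Fin d => bsrc b = x), c b ^ 2 * z (btgt b)) := by
    intro x hx
    rw [W_const hc, wsum_tgt_const hc, wsum_src_const hc, one_pow, one_mul, one_mul, ← Finset.sum_add_distrib]
    have h := hz x (Finset.mem_filter.mp hx).2
    calc 2 * (d : ℝ) * 1 * z x = 2 * d * z x := by ring
      _ ≤ ∑ μ, (z (up x μ) + z (dn x μ)) := h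
      _ = ∑ μ, (z (dn x μ) + z (up x μ)) := Finset.sum_congr rfl fun μ _ => add_comm _ _
  have hmain := meanValueL1_ball hc one_ne_zero x₀ hr1 hN z hz0 hzWN
  -- `R^{-d} ≤ 3^d (2R+1)^{-d}`
  have hr0 : (0 : ℝ) < r := by exact_mod_cast hr1
  have hr1' : (1 : ℝ) ≤ r := by exact_mod_cast hr1
  have hcmp : CL1 d * (∑ x ∈ univ.filter (fun x : UT N => dist x x₀ ≤ r), z x) / (r : ℝ) ^ d ≤
      CMV d / (2 * r + 1 : ℝ) ^ d * ∑ x ∈ univ.filter (fun x : UT N => dist x x₀ ≤ r), z x := by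
    unfold CMV
    rw [div_mul_eq_mul_div, div_le_div_iff₀ (by positivity) (by positivity)]
    have h3 : (2 * r + 1 : ℝ) ^ d ≤ 3 ^ d * (r : ℝ) ^ d := by
      rw [← mul_pow]; exact pow_le_pow_left₀ (by positivity) (by linarith) d
    have h0 : 0 ≤ CL1 d * ∑ x ∈ univ.filter (fun x : UT N => dist x x₀ ≤ r), z x :=
      mul_nonneg (by linarith [one_le_CL1 d]) hS0
    calc CL1 d * (∑ x ∈ univ.filter (fun x : UT N => dist x x₀ ≤ r), z x) * (2 * r + 1 : ℝ) ^ d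
        ≤ CL1 d * (∑ x ∈ univ.filter (fun x : UT N => dist x x₀ ≤ r), z x) * (3 ^ d * (r : ℝ) ^ d) :=
          mul_le_mul_of_nonneg_left h3 h0
      _ = 3 ^ d * CL1 d * (∑ x ∈ univ.filter (fun x : UT N => dist x x₀ ≤ r), z x) * (r : ℝ) ^ d := by ring
  exact hmain.trans hcmp

end

end Summit.QuantumFields.BalabanUV.Beta.SubsolutionMeanValueL1
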